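import Literature.NumberTheory.EllipticCurves.RootNumberTwistProofs
import HarnessLib

/-!
# `aₙ(E^{(−1)}) = χ₄(n) aₙ(E)` for the quadratic twist by `−1`

Let `E/ℚ` be an elliptic curve (any model `W`) and `E^{(−1)} = W.quadraticTwist (−1)` its quadratic
twist by `ℚ(i)`, and write `χ₄ = χ_{−4}` for the non-trivial Dirichlet character mod `4` (Mathlib's
`ZMod.χ₄`; the Kronecker character `(−4/·)` of `ℚ(i)`). The classical identity
`L(E^{(−1)}, s) = L(E ⊗ χ_{−4}, s)`, i.e. `aₙ(E^{(−1)}) = χ₄(n) aₙ(E)` for all `n ≥ 1` (Silverman,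
*AEC* X.2 Prop. 2.4, X.5 Cor. 5.4, Exercise 10.16; Murty–Murty 1997, Ch. 6, §1, `L_D(s, f)` with
`D = −4`), holds place by place for Mathlib's Euler product `WeierstrassCurve.LFunction`:

* at an odd place `v` (prime `ℓ`), `−1` is an `ℓ`-adic unit, so `L_v(E^{(−1)}, T) = L_v(E, χ(ℓ) T)`
  with `χ(ℓ) = 1` iff `−1` is a square mod `ℓ` iff `ℓ ≡ 1 (mod 4)` iff `χ₄(ℓ) = 1`
  (`localEulerFactor_quadraticTwist` of `QuadraticTwistLocalPolynomialProofs`;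
  `localEulerFactor_quadraticTwist_neg_one_of_odd`);
* at the place over `2`, where `χ₄(2) = 0`, the identity says `L_2(E^{(−1)}, T) = 1`, i.e. that
  `E^{(−1)}` has **additive reduction at `2`**. This holds whenever `E` has good or multiplicative
  reduction at `2` (the twist by the character `χ_{−4}`, ramified at `2`, of a semistable curve is
  additive), but the tree has no `2`-adic reduction theory for ramified twists; the additivity is
  therefore taken as the hypothesis `hadd` of `LFunction_quadraticTwist_neg_one_apply`, to be
  discharged curve by curve (e.g. by Tate's algorithm, or by the minimal-model criterion of
  `BSDRankZeroGoodTwistFamily`).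

The place-by-place identities are assembled by `ArithmeticFunction.eulerProduct_apply_eq_mul_of_forall`
(`QuadraticTwistLFunctionProofs`), exactly as in `QuadraticTwistKroneckerLFunctionProofs` (the case of
an odd fundamental discriminant). The file also records the Dirichlet character `χ₄ ⊗ ℂ` mod `4`
(quadratic, primitive of conductor `4`, odd) in the form consumed by the twisting theorems of
`TwistFunctionalEquationModularityProofs` / `TwistRootNumberModularityProofs`.

Everything is proved; no definitions and no named facts are introduced (D-0026).

## References

* [SilvermanAEC2009] J. H. Silverman, *The Arithmetic of Elliptic Curves*, 2nd ed. 2009, X.2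
  Prop. 2.4, X.5 Cor. 5.4, Exercise 10.16.
* [MurtyMurty1997] M. R. Murty, V. K. Murty, *Non-vanishing of `L`-functions and applications*
  (1997), Ch. 6, §1 (`L_D(s, f) = ∑ a(n) χ_D(n) n^{-s}` for a fundamental discriminant `D`).
-/

noncomputable section

open scoped Classical

/-! ### The Dirichlet character `χ₄ ⊗ ℂ` -/

namespace Literature.NumberTheory.EllipticCurves.ModularForms

/-- The values of `χ₄ ⊗ ℂ` at naturals are those of Mathlib's `ZMod.χ₄`. [folklore] -/
theorem χ₄_ringHomComp_apply_natCast (n : ℕ) :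
    (ZMod.χ₄.ringHomComp (Int.castRingHom ℂ)) n = (ZMod.χ₄ n : ℂ) := by
  rw [MulChar.ringHomComp_apply]
  rfl

/-- `χ₄ ⊗ ℂ` is odd: `χ₄(−1) = −1`. [folklore] -/
theorem χ₄_ringHomComp_neg_one : (ZMod.χ₄.ringHomComp (Int.castRingHom ℂ)) (-1) = -1 := by
  rw [MulChar.ringHomComp_apply]
  have h : ZMod.χ₄ (-1) = -1 := by decide
  rw [h]
  simp

/-- `χ₄ ⊗ ℂ` is a quadratic character. [folklore] -/
theorem isQuadratic_χ₄_ringHomComp : (ZMod.χ₄.ringHomComp (Int.castRingHom ℂ)).IsQuadratic :=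
  ZMod.isQuadratic_χ₄.comp _

/-- `χ₄ ⊗ ℂ` is primitive (its conductor is `4`: it is non-trivial, and it does not factor through
level `2`, since `χ₄(3) = −1` while `3 ≡ 1 (mod 2)`). [folklore] -/
theorem isPrimitive_χ₄_ringHomComp :
    DirichletCharacter.IsPrimitive (ZMod.χ₄.ringHomComp (Int.castRingHom ℂ)) := by
  set χ : DirichletCharacter ℂ 4 := ZMod.χ₄.ringHomComp (Int.castRingHom ℂ) with hχdef
  rw [DirichletCharacter.isPrimitive_def]
  have h3 : χ (3 : ℤ) = -1 := by
    rw [hχdef, MulChar.ringHomComp_apply]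
    have h : ZMod.χ₄ ((3 : ℤ) : ZMod 4) = -1 := by decide
    rw [h]
    simp
  -- the conductor divides `4 = 2²` but not `2`
  have hdvd : χ.conductor ∣ 2 ^ 2 := χ.conductor_dvd_level
  have hnot : ¬ χ.conductor ∣ 2 := by
    intro h2
    have hmem : 2 ∈ χ.conductorSet :=
      (χ.mem_conductorSet_iff_conductor_dvd (show 2 ∣ 4 by norm_num)).mpr h2
    obtain ⟨hd, χ₀, hχ₀⟩ := (χ.mem_conductorSet_iff.mp hmem)
    have hcop : IsCoprime (3 : ℤ) (4 : ℕ) := by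
      rw [Int.isCoprime_iff_gcd_eq_one]; decide
    have h3' : χ (3 : ℤ) = χ₀ (3 : ℤ) := by
      rw [hχ₀, DirichletCharacter.changeLevel_eq_cast_of_dvd' χ₀ hd hcop]
    have h31 : ((3 : ℤ) : ZMod 2) = 1 := by decide
    rw [h3, h31, map_one] at h3'
    norm_num at h3'
  obtain ⟨k, hk, hk'⟩ := (Nat.dvd_prime_pow Nat.prime_two).mp hdvd
  interval_cases k
  · exact absurd (hk' ▸ one_dvd 2) hnot
  · exact absurd (hk' ▸ dvd_refl 2) hnot
  · rw [hk']; norm_num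

end Literature.NumberTheory.EllipticCurves.ModularForms

namespace WeierstrassCurve

open IsDedekindDomain IsDedekindDomain.HeightOneSpectrum NumberField Rat.HeightOneSpectrum IsLocalRing
  Literature.NumberTheory.EllipticCurves.ModularForms

variable (W : WeierstrassCurve ℚ) [W.IsElliptic]

/-! ### The local factor of `E^{(−1)}` at an odd place -/

/-- **The local factor of `E^{(−1)}` at an odd place `v`** (prime `ℓ`): it is the rescaling by
`χ₄(ℓ)` of that of `E` — `−1` is an `ℓ`-adic unit, a square mod `ℓ` iff `ℓ ≢ 3 (mod 4)`
(`localEulerFactor_quadraticTwist`, `ZMod.exists_sq_eq_neg_one_iff`). [folklore] -/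
theorem localEulerFactor_quadraticTwist_neg_one_of_odd (v : HeightOneSpectrum (𝓞 ℚ))
    (hv2 : (primesEquiv v : ℕ) ≠ 2) :
    ((W.quadraticTwist (-1)).baseChange (v.adicCompletion ℚ)).localEulerFactor
        (v.adicCompletionIntegers ℚ) =
      ArithmeticFunction.ofPowerSeries (primesEquiv v : ℕ)
        (PowerSeries.rescale (ZMod.χ₄ (primesEquiv v : ℕ))
          ((W.baseChange (v.adicCompletion ℚ)).localPowerSeries (v.adicCompletionIntegers ℚ))) := by
  haveI := Fact.mk (primesEquiv v).2
  haveI : NeZero (2 : v.adicCompletion ℚ) := ⟨by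
    rw [← map_ofNat (algebraMap ℚ (v.adicCompletion ℚ)) 2]; exact (map_ne_zero _).mpr two_ne_zero⟩
  haveI : (W.baseChange (v.adicCompletion ℚ)).IsElliptic := by
    change (W.map _).IsElliptic; infer_instance
  set ℓ : ℕ := (primesEquiv v : ℕ) with hℓ
  have hℓp : ℓ.Prime := (primesEquiv v).2
  have hℓ1 : ¬ (ℓ : ℤ) ∣ (-1 : ℤ) := by
    intro h
    have h1 : (ℓ : ℤ) ∣ 1 := (dvd_neg.mp h)
    have : ℓ ∣ 1 := by exact_mod_cast h1
    exact hℓp.one_lt.ne' (Nat.dvd_one.mp this)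
  have hℓ2 : ¬ (ℓ : ℤ) ∣ 2 := by
    intro h
    have := (Nat.prime_dvd_prime_iff_eq hℓp Nat.prime_two).mp (Int.natCast_dvd_natCast.mp h)
    exact hv2 this
  have hu := isUnit_adicCompletionIntegers_intCast v hℓ1
  have h2 : IsUnit (2 : v.adicCompletionIntegers ℚ) := by
    have := isUnit_adicCompletionIntegers_intCast v hℓ2
    simpa using this
  -- the twist at `v`
  have htw : (W.quadraticTwist (-1)).baseChange (v.adicCompletion ℚ) =
      (W.baseChange (v.adicCompletion ℚ)).quadraticTwist
        (algebraMap (v.adicCompletionIntegers ℚ) (v.adicCompletion ℚ) hu.unit) := by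
    rw [show (-1 : ℚ) = ((-1 : ℤ) : ℚ) by norm_num, baseChange, map_quadraticTwist, IsUnit.unit_spec,
      algebraMap_adicCompletionIntegers_intCast]
    rfl
  rw [htw, localEulerFactor_quadraticTwist (v.adicCompletionIntegers ℚ) h2 _ hu.unit,
    natCard_residueField_adicCompletionIntegers v]
  congr 2
  -- the sign: `-1` is a square in the residue field iff `ℓ % 4 ≠ 3`
  obtain ⟨e, he⟩ := exists_residueField_ringEquiv_zmod v
  have hsq : IsSquare (residue _ ((hu.unit : (v.adicCompletionIntegers ℚ)ˣ) : v.adicCompletionIntegers ℚ)) ↔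
      IsSquare (((-1 : ℤ) : ZMod ℓ)) := by
    rw [IsUnit.unit_spec, ← isSquare_ringEquiv_iff e.toMulEquiv, RingEquiv.toMulEquiv_eq_coe,
      RingEquiv.coe_toMulEquiv, he]
  have hsq' : IsSquare (residue _ ((hu.unit : (v.adicCompletionIntegers ℚ)ˣ) : v.adicCompletionIntegers ℚ)) ↔
      ℓ % 4 ≠ 3 := by
    rw [hsq, Int.cast_neg, Int.cast_one]
    exact ZMod.exists_sq_eq_neg_one_iff
  have hodd : ℓ % 2 = 1 := Nat.odd_iff.mp (hℓp.odd_of_ne_two hv2)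
  by_cases h3 : ℓ % 4 = 3
  · rw [if_neg (fun h ↦ (hsq'.mp h) h3), ZMod.χ₄_nat_three_mod_four h3]
  · rw [if_pos (hsq'.mpr h3), ZMod.χ₄_nat_one_mod_four (by omega)]

/-! ### The global identity -/

/-- **`aₙ(E^{(−1)}) = χ₄(n) aₙ(E)` for all `n`** (Silverman, *AEC* X.2, X.5 Cor. 5.4,
Exercise 10.16; Murty–Murty 1997, Ch. 6, §1 with `D = −4`), for an elliptic curve `E / ℚ` (any model
`W`) whose twist `E^{(−1)} = W.quadraticTwist (−1)` has additive reduction at the place over `2`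
(hypothesis `hadd`; automatic when `E` is semistable at `2`, see the module docstring): the Dirichlet
coefficients of Mathlib's `L`-function of `E^{(−1)}` are those of `E` twisted by `χ₄ = (−4/·)` —
including at the powers of `2`, where both sides vanish. [cite: SilvermanAEC2009, X.5 Cor. 5.4 and Exercise 10.16] -/
theorem LFunction_quadraticTwist_neg_one_apply
    (hadd : ∀ v : HeightOneSpectrum (𝓞 ℚ), (primesEquiv v : ℕ) = 2 →
      (W.quadraticTwist (-1)).HasAdditiveReductionAt v)
    (n : ℕ) : (W.quadraticTwist (-1)).LFunction n = ZMod.χ₄ n * W.LFunction n := by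
  haveI : (W.quadraticTwist (-1 : ℚ)).IsElliptic := W.isElliptic_quadraticTwist (by norm_num)
  rw [LFunction_eq_eulerProduct, LFunction_eq_eulerProduct]
  refine ArithmeticFunction.eulerProduct_apply_eq_mul_of_forall (P := fun _ ↦ True)
    (fun _ _ _ ↦ ⟨trivial, trivial⟩) (fun n : ℕ ↦ (ZMod.χ₄ n : ℤ))
    (by simp) (fun m n ↦ by rw [Nat.cast_mul, map_mul]) _ _ (fun v m _ ↦ ?_)
    (eventually_cofinite_localEulerFactor_apply _) (eventually_cofinite_localEulerFactor_apply _) trivial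
  haveI := Fact.mk (primesEquiv v).2
  have hℓ1 : 1 < (primesEquiv v : ℕ) := (primesEquiv v).2.one_lt
  by_cases hv2 : (primesEquiv v : ℕ) = 2
  · -- the place over `2`: the factor of the twist is trivial and `χ₄(2^k) = 0`
    rw [localEulerFactor_eq_one_of_hasAdditiveReduction _ (hadd v hv2), ArithmeticFunction.one_apply]
    split_ifs with hm1
    · rw [hm1, localEulerFactor_apply_one, Nat.cast_one, map_one, one_mul]
    · by_cases hpow : ∃ k, Nat.card (ResidueField (v.adicCompletionIntegers ℚ)) ^ k = m
      · obtain ⟨k, rfl⟩ := hpow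
        rw [natCard_residueField_adicCompletionIntegers] at hm1 ⊢
        have hk : k ≠ 0 := fun h ↦ hm1 (by rw [h, pow_zero])
        obtain ⟨j, rfl⟩ := Nat.exists_eq_succ_of_ne_zero hk
        have h0 : ZMod.χ₄ (((primesEquiv v : ℕ) ^ (j + 1) : ℕ) : ZMod 4) = 0 := by
          rw [ZMod.χ₄_nat_eq_if_mod_four, if_pos]
          rw [hv2, pow_succ, Nat.mul_mod_left]
        rw [h0, zero_mul]
      · rw [localEulerFactor_apply_eq_zero _ _ (by rwa [natCard_residueField_adicCompletionIntegers]) hpow,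
          mul_zero]
  · -- an odd place
    rw [W.localEulerFactor_quadraticTwist_neg_one_of_odd v hv2, localEulerFactor,
      natCard_residueField_adicCompletionIntegers]
    exact ArithmeticFunction.ofPowerSeries_rescale_apply hℓ1 (fun n : ℕ ↦ (ZMod.χ₄ n : ℤ))
      (by simp) (fun m n ↦ by rw [Nat.cast_mul, map_mul]) _ m

/-- **`aₙ(E^{(−1)}) = χ₄(n) aₙ(E)` in `ℂ`**, with `χ₄ ⊗ ℂ` the primitive quadratic Dirichlet
character mod `4` (the form consumed by the twisting theorems of
`TwistFunctionalEquationModularityProofs`). [cite: SilvermanAEC2009, X.5 Cor. 5.4 and Exercise 10.16] -/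
theorem LFunction_quadraticTwist_neg_one_apply_complex
    (hadd : ∀ v : HeightOneSpectrum (𝓞 ℚ), (primesEquiv v : ℕ) = 2 →
      (W.quadraticTwist (-1)).HasAdditiveReductionAt v)
    (n : ℕ) :
    (((W.quadraticTwist (-1)).LFunction n : ℤ) : ℂ) =
      (ZMod.χ₄.ringHomComp (Int.castRingHom ℂ)) n * (W.LFunction n : ℂ) := by
  rw [W.LFunction_quadraticTwist_neg_one_apply hadd n, Int.cast_mul, χ₄_ringHomComp_apply_natCast]

end WeierstrassCurve

end
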